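import Mathlib
import HarnessLib
import Summits.NavierStokesRegularity.NavierStokesRegularity.Theorems.ThreadingFluxHorizonTowerCoaxialOrderOne
import Summits.NavierStokesRegularity.NavierStokesRegularity.Theorems.ThreadingFluxHorizonTowerDipoleTowerOrderOne

/-!
# Crux `PoloidalLiouville` (stmt-NavierStokesRegularity-1222, wall W1), crux idea «horizon-threading-tower» (ns-idea-15):
# DIPOLE-TOWER IFF — the three-mode stationary sphere-Euler flows with a dipole mode are CHARACTERISED

ARM A (ns-exp-scalarLiouville g6), menu item I-1 (2026-08-29T06:16Z; crit-1 g5: S · NO STRIKE · information).  Packages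
`dipoleTowerHorizonZonality_of`'s rotational core (p700930: `dipoleTower_zonal_of_even_odd` / `_of_odd_even` / `_of_even_even`) with the
converse `dipoleTower_horizonL1_eq_zero_of_coaxial` (O1, p702870) into one `↔`: for non-zero `A ∈ 𝓗_1`, `B ∈ 𝓗_m`, `C ∈ 𝓗_n`,
`2 ≤ m ≠ n`, `m, n` not both odd, `𝔏₁[U_A + U_B + U_C] ≡ 0` off the centre IFF the three shells are zonal about one common axis.

HONEST LABEL: information-grade characterisation; `HorizonTowerZonality`, `PoloidalLiouville` (1222) and NS regularity are OPEN / NOT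
proved; nothing here is an NS statement.  `--supports stmt-NavierStokesRegularity-1222 --as helper`.
-/

-- the summit and its single sub-problem share the name (CONVENTIONS §1)
set_option linter.dupNamespace false

noncomputable section

namespace Summit.NavierStokesRegularity.NavierStokesRegularity.Theorems.PoloidalLiouville.HorizonTower

open Set Function Filter Topology
open scoped RealInnerProductSpace
open Literature.Analysis.FluidPDE

section DipoleTowerIff

/-- ★★ **DIPOLE-TOWER IFF** (characterisation of the three-mode stationary sphere-Euler flows with a dipole mode): for non-zero solid
harmonics `A ∈ 𝓗_1`, `B ∈ 𝓗_m`, `C ∈ 𝓗_n`, `2 ≤ m, n`, `m ≠ n`, `m, n` not both odd, the tower `U_A + U_B + U_C` is annihilated by `𝔏₁` off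
the centre IF AND ONLY IF the three shells are zonal about one common axis (rotational form).  `→` is `dipoleTowerHorizonZonality_of`'s
rotational core (p700930), `←` is `dipoleTower_horizonL1_eq_zero_of_coaxial`. [folklore] -/
theorem dipoleTower_horizonL1_iff_coaxial {m n : ℕ} {A B C : E3 → ℝ} (hm : 2 ≤ m) (hn : 2 ≤ n) (hmn : m ≠ n)
    (hpar : Even m ∨ Even n)
    (hA : ContDiff ℝ (⊤ : ℕ∞) A) (hhomA : ∀ (c : ℝ) (y : E3), A (c • y) = c ^ 1 * A y) (hharmA : ∀ y, Laplacian.laplacian A y = 0)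
    (hB : ContDiff ℝ (⊤ : ℕ∞) B) (hhomB : ∀ (c : ℝ) (y : E3), B (c • y) = c ^ m * B y) (hharmB : ∀ y, Laplacian.laplacian B y = 0)
    (hC : ContDiff ℝ (⊤ : ℕ∞) C) (hhomC : ∀ (c : ℝ) (y : E3), C (c • y) = c ^ n * C y) (hharmC : ∀ y, Laplacian.laplacian C y = 0)
    (hA0 : ∃ y, A y ≠ 0) (hB0 : ∃ y, B y ≠ 0) (hC0 : ∃ y, C y ≠ 0) :
    (∀ x : E3, x ≠ 0 → horizonL1 (fun z => horizonProfile 1 A 0 z + horizonProfile m B 0 z + horizonProfile n C 0 z) 0 x = 0) ↔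
      ∃ a : E3, a ≠ 0 ∧ (∀ x : E3, ⟪cross a x, gradient A x⟫ = 0) ∧ (∀ x : E3, ⟪cross a x, gradient B x⟫ = 0) ∧
        (∀ x : E3, ⟪cross a x, gradient C x⟫ = 0) := by
  constructor
  · intro hL1
    rcases Nat.even_or_odd m with hme | hmo <;> rcases Nat.even_or_odd n with hne | hno
    · exact dipoleTower_zonal_of_even_even hm hn hmn hme hne hA hhomA hharmA hB hhomB hharmB hC hhomC hharmC hB0 hC0 hL1
    · exact dipoleTower_zonal_of_even_odd hm hn hmn hme hno hA hhomA hharmA hB hhomB hharmB hC hhomC hharmC hA0 hC0 hL1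
    · exact dipoleTower_zonal_of_odd_even hm hn hmn hmo hne hA hhomA hharmA hB hhomB hharmB hC hhomC hharmC hA0 hB0 hL1
    · exfalso
      rcases hpar with h | h
      · exact (Nat.not_even_iff_odd.2 hmo) h
      · exact (Nat.not_even_iff_odd.2 hno) h
  · rintro ⟨a, ha, hAz, hBz, hCz⟩ x hx
    exact dipoleTower_horizonL1_eq_zero_of_coaxial hm hn hmn hA hhomA hharmA hB hhomB hharmB hC hhomC hharmC ha hAz hBz hCz hx

end DipoleTowerIff

end Summit.NavierStokesRegularity.NavierStokesRegularity.Theorems.PoloidalLiouville.HorizonTower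

end
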